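import Literature.Barriers.CriticalPhenomena.PlaquetteWalkHoleRootRowOnly
import HarnessLib

/-!
# Barrier catalogue (SAWScalingLimit): no cost-`7` vertical-end parent of a level-`5` class-`B2b` member returns to a rhombus of the HOLE ROW west of the hole
(«NO LEVEL-5 B2b PARENT ON THE HOLE ROW WEST OF THE HOLE»)

`Z → ∞` limit model of the printed Yang–Baxter weights [GlazmanManolescu2019, §1, eq. (1)]; the «RECTANGLE COEFFICIENT» line of the venture lane «pcv-sawmu»
(b-engine-1 g28). Companion of `PlaquetteWalkHoleRootWestColumnSeven` (the rhombi OFF the hole row): here the rooted rhombus `r` lies ON the hole row, west of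
the hole (`r.2 = w.2`, `r.1 < w.1`).

* ★★★★ `ΩG.not_cost_seven_vert_rootRow_west`: no wound class-`B2a` walk of limit cost `7` from the hole root `w.side W` (hole `(w.1 − 1, w.2)` absent) with a
  turning first arc in `r` ends on a VERTICAL side of such an `r`. CHAIN CALCULUS ONLY: the six isolated turns are the two top-row turns, the two bottom-row turns,
  the root-row turn `τ = (τ1, w.2)` (`τ1 ≥ w.1`, east end of the first turn's chain) and `r` itself — so every isolated turn strictly between the extreme rows is
  `r` or `τ`. The last plaquette `L = (r.1 ± 1, w.2)` then has nowhere to send its horizontal chain: for the `W` end (`L` west of `r`, left through `E`) the west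
  chain of `L` would end at an isolated hole-row turn west of `r`; for the `E` end (`L` between `r` and the hole, left through `W`) the east chain of `L` would
  end at `τ`, east of the hole — running THROUGH the absent hole plaquette.

Census support: kit j276221 / j298353 (3 455 rooted domains): the minimal wound cost on the hole row west of the hole is `9`.
[GlazmanManolescu2019 §1 Fig. 1, eq. (1), Lemma 2.1, Remark 2.2; Glazman2015WeightedSAW Lemma 3.1 (proof, pp. 6–7); CourantRobbins1958 Ch. V App. §2]
-/

noncomputable section

namespace Literature.Probability.RandomPlanarGeometry.SAW.YangBaxter

open Real
open Literature.Barriers.CriticalPhenomena.PlaquetteWalk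

open private fc_fh fh_add_Mv three_le_Mv from Literature.Probability.RandomPlanarGeometry.YangBaxterSAWGeneralDomain

namespace ΩG

variable {D : Set Face} {w r : Face} {ω : ΩG D (w.side .W) r}

/-- ★★★★ **NO COST-`7` VERTICAL-END PARENT ON THE HOLE ROW WEST OF THE HOLE.** A wound class-`B2a` walk of limit cost `7` from the hole root `w.side W` (hole
absent) with a turning first arc in `r` does not end on a vertical side of a rhombus `r` of the hole row west of the hole (`r.2 = w.2`, `r.1 < w.1`).
[cite: GlazmanManolescu2019, §1, Fig. 1 and eq. (1); Lemma 2.1 (proof: the groups); Remark 2.2] [cite: Glazman2015WeightedSAW, Lemma 3.1 (proof, pp. 6–7)]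
[cite: CourantRobbins1958, Ch. V Appendix §2 (the even–odd rule)] -/
theorem not_cost_seven_vert_rootRow_west (hh : holeFaceW w ∉ D) (hr : RootedFace D (w.side .W) r) (h : ω.IsB2a)
    (hA : ω.AJ hr h (toC (midPt (w.side .W))) ≠ 0) (hc : cost (slotOfSide ω.1) ω.2.mids = 7) (hz : ω.1 = .E ∨ ω.1 = .W)
    (hNS : arcKind (ω.2.sIn ω.2.firstHitG) (ω.2.sOut ω.2.firstHitG) ≠ .straight) (hrow : r.2 = w.2) (hwest : r.1 < w.1) : False := by
  classical
  set n := ω.2.arcs.length with hn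
  ---------------------------------------------------------------- basics
  have hF := ω.fh_lt h
  have hlen : 0 < n := by omega
  have h0w : ω.2.fc 0 = w := fc_zero_eq_root w hh ω.2 hlen
  have h0W : ω.2.sIn 0 = .W := YBWalk.sIn_zero_eq_W hh ω.2 hlen
  have h0E : ω.2.sIn 0 ≠ .E := by rw [h0W]; decide
  have hfcF := (fc_fh ω hr h).1
  have hsvr : ∀ l < n, ω.2.fc l = ω.2.fc ω.2.firstHitG → l = ω.2.firstHitG := fun l hl e => eq_firstHitG_of_fc_eq hr h hl e
  have hfne3 : ω.2.firstHitG + 3 ≤ n := by have := three_le_Mv hr h; have := fh_add_Mv h; unfold ΩG.Mv at *; omega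
  have hn1 : n - 1 < n := by omega
  have hrD : r ∈ D := by rw [← hfcF]; exact (YBWalk.arcFace_arcAt hF).2
  have hLD : ω.2.fc (n - 1) ∈ D := (YBWalk.arcFace_arcAt hn1).2
  have hr2 : r.1 ≤ w.1 - 2 := by
    by_contra hlt
    have e : r = holeFaceW w := Prod.ext (by simp only [holeFaceW]; omega) (by simp only [holeFaceW]; exact hrow)
    exact hh (e ▸ hrD)
  have hlast := last_of_vertical_end hr h hz
  ---------------------------------------------------------------- isolated turns: six, as `P`-cells
  have h6 : cfgCount ω.2.mids [.corner] + cfgCount ω.2.mids [.coCorner] = 6 := by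
    have hcost : cost (slotOfSide ω.1) ω.2.mids =
        cfgCount ω.2.mids [.corner] + cfgCount ω.2.mids [.coCorner] + (1 - slotDeg (slotOfSide ω.1)) := rfl
    have hd : slotDeg (slotOfSide ω.1) = 0 := by rcases hz with e | e <;> rw [e] <;> rfl
    rw [hcost, hd] at hc; omega
  let P : Face → Prop := fun f => f ∈ facesL ω.2.mids ∧ (kindsL ω.2.mids f = [.corner] ∨ kindsL ω.2.mids f = [.coCorner])
  have hPiso : ∀ k < n, (∀ l < n, ω.2.fc l = ω.2.fc k → l = k) → arcKind (ω.2.sIn k) (ω.2.sOut k) ≠ .straight → P (ω.2.fc k) :=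
    fun k hk hsv hkind => isolated_turn hk hsv hkind
  have hle6 : ∀ T : Finset Face, (∀ f ∈ T, P f) → T.card ≤ 6 := by
    intro T hT; have := YBWalk.card_le_cfgCount_add ω.2.mids T hT; omega
  have hPr : P r := by have := hPiso _ hF hsvr hNS; rwa [hfcF] at this
  -- two top-row turns, two bottom-row turns
  obtain ⟨Y, hYw, hY, Tt, hTtP, hTtrow, hTtcard⟩ := two_top_turns hh hr h hA
  have hTt2 : 1 < Tt.card := by
    rcases hTtcard with h2 | ⟨-, -, hrY⟩
    · omega
    · exfalso; omega
  obtain ⟨t₁, ht₁, t₂, ht₂, ht12⟩ := Finset.one_lt_card.1 hTt2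
  have hPt₁ : P t₁ := hTtP t₁ ht₁
  have hPt₂ : P t₂ := hTtP t₂ ht₂
  have ht₁row : t₁.2 = Y := hTtrow t₁ ht₁
  have ht₂row : t₂.2 = Y := hTtrow t₂ ht₂
  obtain ⟨Y', hY'w, hY', Tb, hTbP, hTbrow, hTbcard⟩ := two_bottom_turns hh hr h hA
  have hTb2 : 1 < Tb.card := by
    rcases hTbcard with h2 | ⟨-, -, hrY⟩
    · omega
    · exfalso; omega
  obtain ⟨b₁, hb₁, b₂, hb₂, hb12⟩ := Finset.one_lt_card.1 hTb2
  have hPb₁ : P b₁ := hTbP b₁ hb₁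
  have hPb₂ : P b₂ := hTbP b₂ hb₂
  have hb₁row : b₁.2 = Y' := hTbrow b₁ hb₁
  have hb₂row : b₂.2 = Y' := hTbrow b₂ hb₂
  obtain ⟨X', -, hX', -⟩ := exists_right_entry_turn hh hr h
  obtain ⟨X, hXw, hX, -⟩ := exists_left_entry_turn hh hr h hA
  ---------------------------------------------------------------- the first turn and the root-row turn `τ = (τ1, w.2)`, `τ1 ≥ w.1`
  have hexk : ∃ k, k < n ∧ arcKind (ω.2.sIn k) (ω.2.sOut k) ≠ .straight := ⟨_, hF, hNS⟩
  obtain ⟨hk₁, -⟩ := Nat.find_spec hexk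
  set k₁ := Nat.find hexk with hk₁def
  have hstr : ∀ i < k₁, arcKind (ω.2.sIn i) (ω.2.sOut i) = .straight := by
    intro i hi; by_contra hne; exact Nat.find_min hexk hi ⟨by omega, hne⟩
  obtain ⟨hrun, -⟩ := ω.2.initial_run hh hk₁ hstr
  obtain ⟨hfk, hWk⟩ := hrun k₁ le_rfl
  have hp₁W : ω.2.UsesSide (w.1 + k₁, w.2) .W := ⟨k₁, hk₁, hfk, Or.inl hWk⟩
  obtain ⟨τ1, hPτ, hτ1w⟩ : ∃ τ1 : ℤ, P (τ1, w.2) ∧ w.1 + k₁ ≤ τ1 := by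
    by_cases hpE : ω.2.UsesSide (w.1 + k₁, w.2) .E
    · obtain ⟨M, hWall, -, hend⟩ := ω.2.chain_E hX' hpE
      rcases hend with ⟨hM1, hnot⟩ | ⟨-, hs0⟩ | ⟨hZ, hsZ⟩
      · obtain ⟨i', hi', hfc', hsv', -, -, -, hk'⟩ := ω.2.isolated_of_usesSide_not_opp (hWall M hM1 le_rfl) hnot
        refine ⟨w.1 + k₁ + M, ?_, by omega⟩
        have := hPiso i' hi' hsv' hk'; rw [hfc'] at this; exact this
      · exact absurd hs0 h0E
      · exfalso
        rcases hlast with ⟨-, hsW, -⟩ | ⟨-, -, hL⟩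
        · rw [hsW] at hsZ; exact absurd hsZ (by decide)
        · rw [hL] at hZ; have := congrArg Prod.fst hZ; simp only at this; omega
    · obtain ⟨i', hi', hfc', hsv', -, -, -, hk'⟩ := ω.2.isolated_of_usesSide_not_opp hp₁W hpE
      refine ⟨w.1 + k₁, ?_, le_rfl⟩
      have := hPiso i' hi' hsv' hk'; rw [hfc'] at this; exact this
  ---------------------------------------------------------------- outsiders: every isolated turn strictly between the extreme rows is `r` or `τ`
  have hne_of_row : ∀ f g : Face, f.2 ≠ g.2 → f ≠ g := fun f g hfg e => hfg (by rw [e])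
  have houts : ∀ g : Face, P g → g ≠ t₁ → g ≠ t₂ → g ≠ b₁ → g ≠ b₂ → g ≠ ((τ1 : ℤ), w.2) → g ≠ r → False := by
    intro g hPg n0 n1 n2 n3 n4 n5
    have h01 : t₁ ≠ t₂ := ht12
    have h02 : t₁ ≠ b₁ := hne_of_row _ _ (by rw [ht₁row, hb₁row]; omega)
    have h03 : t₁ ≠ b₂ := hne_of_row _ _ (by rw [ht₁row, hb₂row]; omega)
    have h04 : t₁ ≠ ((τ1 : ℤ), w.2) := hne_of_row _ _ (by rw [ht₁row]; simp only; omega)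
    have h05 : t₁ ≠ r := hne_of_row _ _ (by rw [ht₁row]; omega)
    have h12 : t₂ ≠ b₁ := hne_of_row _ _ (by rw [ht₂row, hb₁row]; omega)
    have h13 : t₂ ≠ b₂ := hne_of_row _ _ (by rw [ht₂row, hb₂row]; omega)
    have h14 : t₂ ≠ ((τ1 : ℤ), w.2) := hne_of_row _ _ (by rw [ht₂row]; simp only; omega)
    have h15 : t₂ ≠ r := hne_of_row _ _ (by rw [ht₂row]; omega)
    have h23 : b₁ ≠ b₂ := hb12
    have h24 : b₁ ≠ ((τ1 : ℤ), w.2) := hne_of_row _ _ (by rw [hb₁row]; simp only; omega)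
    have h25 : b₁ ≠ r := hne_of_row _ _ (by rw [hb₁row]; omega)
    have h34 : b₂ ≠ ((τ1 : ℤ), w.2) := hne_of_row _ _ (by rw [hb₂row]; simp only; omega)
    have h35 : b₂ ≠ r := hne_of_row _ _ (by rw [hb₂row]; omega)
    have h45 : ((τ1 : ℤ), w.2) ≠ r := by intro e; have := congrArg Prod.fst e; simp only at this; omega
    have hT : ∀ f ∈ ({g, t₁, t₂, b₁, b₂, ((τ1 : ℤ), w.2), r} : Finset Face), P f := by
      intro f hf
      simp only [Finset.mem_insert, Finset.mem_singleton] at hf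
      rcases hf with rfl | rfl | rfl | rfl | rfl | rfl | rfl
      exacts [hPg, hPt₁, hPt₂, hPb₁, hPb₂, hPτ, hPr]
    have hcard : ({g, t₁, t₂, b₁, b₂, ((τ1 : ℤ), w.2), r} : Finset Face).card = 7 := by
      rw [Finset.card_insert_of_notMem (by simp only [Finset.mem_insert, Finset.mem_singleton, not_or]; exact ⟨n0, n1, n2, n3, n4, n5⟩),
        Finset.card_insert_of_notMem (by simp only [Finset.mem_insert, Finset.mem_singleton, not_or]; exact ⟨h01, h02, h03, h04, h05⟩),
        Finset.card_insert_of_notMem (by simp only [Finset.mem_insert, Finset.mem_singleton, not_or]; exact ⟨h12, h13, h14, h15⟩),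
        Finset.card_insert_of_notMem (by simp only [Finset.mem_insert, Finset.mem_singleton, not_or]; exact ⟨h23, h24, h25⟩),
        Finset.card_insert_of_notMem (by simp only [Finset.mem_insert, Finset.mem_singleton, not_or]; exact ⟨h34, h35⟩),
        Finset.card_insert_of_notMem (by simp only [Finset.mem_singleton]; exact h45), Finset.card_singleton]
    have := hle6 _ hT
    omega
  have hmid : ∀ f, P f → Y' < f.2 → f.2 < Y → f = r ∨ f = ((τ1 : ℤ), w.2) := by
    intro f hf h1 h2
    by_contra hno
    push Not at hno
    exact houts f hf (hne_of_row _ _ (by rw [ht₁row]; omega)) (hne_of_row _ _ (by rw [ht₂row]; omega))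
      (hne_of_row _ _ (by rw [hb₁row]; omega)) (hne_of_row _ _ (by rw [hb₂row]; omega)) hno.2 hno.1
  -- the last plaquette is not an isolated turn
  have hLnotP : ¬P (ω.2.fc (n - 1)) := by
    intro hP
    have hrowL : (ω.2.fc (n - 1)).2 = w.2 := by
      rcases hlast with ⟨-, -, hL⟩ | ⟨-, -, hL⟩ <;> rw [hL] <;> exact hrow
    rcases hmid _ hP (by omega) (by omega) with e | e
    · exact fc_last_ne_root hr h e
    · rcases hlast with ⟨-, -, hL⟩ | ⟨-, -, hL⟩
      · rw [hL] at e; have := congrArg Prod.fst e; simp only at this; omega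
      · rw [hL] at e; have := congrArg Prod.fst e; simp only at this; omega
  -- hence it uses all four sides as soon as its arc turns
  have hLall : arcKind (ω.2.sIn (n - 1)) (ω.2.sOut (n - 1)) ≠ .straight → ∀ s, ω.2.UsesSide (ω.2.fc (n - 1)) s := by
    intro hk s
    have hdouble : ¬∀ l < n, ω.2.fc l = ω.2.fc (n - 1) → l = n - 1 := fun hsv => hLnotP (hPiso _ hn1 hsv hk)
    push Not at hdouble
    obtain ⟨l, hl, hfl, hne⟩ := hdouble
    have := ω.2.usesSide_of_fc_eq hl hn1 hne hfl s
    rwa [hfl] at this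
  ---------------------------------------------------------------- the two vertical ends
  rcases hlast with ⟨hωE, hsW, hL⟩ | ⟨hωW, hsE, hL⟩
  · ---------------------------------------------------------------- `ω.1 = E`: `L = (r.1 + 1, w.2)` lies between `r` and the hole; its east chain would run through the hole
    rw [hrow] at hL
    have hr3 : r.1 ≤ w.1 - 3 := by
      by_contra hlt
      have e : ω.2.fc (n - 1) = holeFaceW w := by rw [hL]; exact Prod.ext (by simp only [holeFaceW]; omega) rfl
      exact hh (e ▸ hLD)
    have hLE : ω.2.UsesSide (r.1 + 1, w.2) .E := by
      have hne := ω.2.sIn_ne_sOut hn1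
      rw [hsW] at hne
      by_cases hE : ω.2.sIn (n - 1) = .E
      · exact ⟨_, hn1, hL, Or.inl hE⟩
      · have hk : arcKind (ω.2.sIn (n - 1)) (ω.2.sOut (n - 1)) ≠ .straight := by
          revert hne hE; rw [hsW]; cases ω.2.sIn (n - 1) <;> decide
        have := hLall hk .E; rwa [hL] at this
    obtain ⟨M, hWall, -, hend⟩ := ω.2.chain_E hX' hLE
    rcases hend with ⟨hM1, hnot⟩ | ⟨-, hs0⟩ | ⟨-, hsZ⟩
    · obtain ⟨i', hi', hfc', hsv', -, -, -, hk'⟩ := ω.2.isolated_of_usesSide_not_opp (hWall M hM1 le_rfl) hnot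
      have hP' : P (r.1 + 1 + M, w.2) := by rw [← hfc']; exact hPiso i' hi' hsv' hk'
      rcases hmid _ hP' (by simp only; omega) (by simp only; omega) with e | e
      · have := congrArg Prod.fst e; simp only at this; omega
      · have eτ := congrArg Prod.fst e; simp only at eτ
        -- the hole is a chain cell
        obtain ⟨mh, hmh⟩ : ∃ mh : ℕ, (mh : ℤ) = w.1 - 2 - r.1 := ⟨(w.1 - 2 - r.1).toNat, by omega⟩
        have huse := hWall mh (by omega) (by omega)
        obtain ⟨j, hj, hfj⟩ := ω.2.exists_fc_eq_of_usesSide huse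
        have e' : ω.2.fc j = holeFaceW w := by rw [hfj]; exact Prod.ext (by simp only [holeFaceW]; omega) rfl
        exact hh (e' ▸ (YBWalk.arcFace_arcAt hj).2)
    · exact absurd hs0 h0E
    · rw [hsW] at hsZ; exact absurd hsZ (by decide)
  · ---------------------------------------------------------------- `ω.1 = W`: `L = (r.1 − 1, w.2)`; its west chain has no end
    rw [hrow] at hL
    have hLW : ω.2.UsesSide (r.1 - 1, w.2) .W := by
      have hne := ω.2.sIn_ne_sOut hn1
      rw [hsE] at hne
      by_cases hW : ω.2.sIn (n - 1) = .W
      · exact ⟨_, hn1, hL, Or.inl hW⟩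
      · have hk : arcKind (ω.2.sIn (n - 1)) (ω.2.sOut (n - 1)) ≠ .straight := by
          revert hne hW; rw [hsE]; cases ω.2.sIn (n - 1) <;> decide
        have := hLall hk .W; rwa [hL] at this
    obtain ⟨M, hEall, -, hend⟩ := ω.2.chain_W hX hLW
    rcases hend with ⟨hM1, hnot⟩ | ⟨hA0, -⟩ | ⟨-, hsZ⟩
    · obtain ⟨i', hi', hfc', hsv', -, -, -, hk'⟩ := ω.2.isolated_of_usesSide_not_opp (hEall M hM1 le_rfl) hnot
      have hP' : P (r.1 - 1 - M, w.2) := by rw [← hfc']; exact hPiso i' hi' hsv' hk'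
      rcases hmid _ hP' (by simp only; omega) (by simp only; omega) with e | e
      · have := congrArg Prod.fst e; simp only at this; omega
      · have := congrArg Prod.fst e; simp only at this; omega
    · rw [h0w] at hA0; have := congrArg Prod.fst hA0; simp only at this; omega
    · rw [hsE] at hsZ; exact absurd hsZ (by decide)

end ΩG

end Literature.Probability.RandomPlanarGeometry.SAW.YangBaxter
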